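import Summits.PneNP.PneNP.Theorems.ChebyshevTracialDesignTightOddLayers
import Summits.PneNP.PneNP.Theorems.ChebyshevTracialDesignPairTransitive
import HarnessLib

/-!
# Cell pnp-psdrank, route `ChebyshevTracialDesign`: the σ₂ brick assembled modulo the even ladder eigenvalues —
# tight-free rectangles of (t-cuts) × (perfect matchings) are spectrally small

Harmonic backbone, brick 5d (assembly). Lit's zero-rectangle mixing bound
(`JohnsonSpectrum.card_mul_card_mul_sq_le_of_sum_eq_zero`, p437261: Haemers/expander-mixing for a matrix on
(`t`-sets) × `β` whose Gram kernel is a Johnson class function) is instantiated for the TIGHT INCIDENCE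
`A(U,M) = 1[cc(U,M) = 1]` of Rothvoß's slack matrix [cite: Rothvoss2017, §2 (PDF p. 6): the rectangles of a
nonnegative factorization avoid the tight pairs]: its Gram kernel is a class function (`exists_tightGram_classFunction`,
from `card_jointTight_eq`, p430440), its column sums are constant (`tight_colSum_eq`, from `colCount_eq`, p425886), and
its ODD ladder eigenvalues vanish (`kernelEigen_tight_eq_zero_of_odd`, brick 5c). RESULT `tightFree_card_mul_card_le`:
if `Λ ≥ 0` bounds the EVEN ladder eigenvalues `kernelEigen n t (2κ') κ`, `1 ≤ κ' ≤ (t−1)/2`, of the tight Gram class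
function, then every rectangle `X × Y` of `t`-cuts and perfect matchings WITHOUT a tight pair satisfies
`|X|·|Y|·d_C² ≤ Λ·C(n,t)·(C(n,t) − |X|)`, i.e. `μν ≤ (1 − μ)·Λ/λ₀` with `λ₀ = d_R d_C`
[cite: GodsilMeagher2015, §15.2 (perfect matching scheme)]. With MEMO-7 (★★) (`Λ = λ₂ ≈ λ₀/n`, pending its kernel count)
this is the σ₂ brick "tight-free ⇒ μν < 1/n" of the r = 1 rung. WHAT THIS IS NOT: the even eigenvalues are a
hypothesis here; nothing on psd rank. Supports crux stmt-PneNP-19878.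
-/

set_option linter.dupNamespace false -- `Summit.PneNP.PneNP.…`: summit = sub-problem (D-0017)

noncomputable section

namespace Summit.PneNP.PneNP.Theorems.ChebyshevTracialDesignTightFreeSpectral

open Finset Literature.Combinatorics.AssociationSchemes Literature.Combinatorics.AssociationSchemes.JohnsonHarmonics
open Literature.Combinatorics.AssociationSchemes.JohnsonSpectrum
open Literature.Barriers.PneNP
open Summit.PneNP.PneNP.Theorems.ChebyshevTracialDesignTightColumnSums
open Summit.PneNP.PneNP.Theorems.ChebyshevTracialDesignTightOddLayers
open Summit.PneNP.PneNP.Theorems.ChebyshevTracialDesignPairTransitive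
open Summit.PneNP.PneNP.Theorems.ChebyshevTracialDesignLevelMarginals

variable {n : ℕ}

/-! ### §1 The tight incidence on `t`-subsets: Gram sums and column sums as level counts -/

/-- The Gram sum of the tight incidence at two odd `t`-sets is the joint tight count of the route vocabulary. -/
theorem tightGram_eq_card {U U' : Finset (Fin n)} (hU : Odd U.card) (hU' : Odd U'.card) :
    ∑ M : PMatch n, (if (U.filter fun x => M.2.partner x ∉ U).card = 1 then (1 : ℝ) else 0) *
        (if (U'.filter fun x => M.2.partner x ∉ U').card = 1 then (1 : ℝ) else 0) =
      ((univ.filter fun M : PMatch n => cc ⟨U, hU⟩ M = 1 ∧ cc ⟨U', hU'⟩ M = 1).card : ℝ) := by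
  rw [← sum_boole]
  refine sum_congr rfl fun M _ => ?_
  rw [cc_eq_card_filter_partner ⟨U, hU⟩ M, cc_eq_card_filter_partner ⟨U', hU'⟩ M]
  simp only
  split_ifs <;> simp_all

/-- **The Gram kernel of the tight incidence on the `t`-subsets (`t` odd) is a class function.** -/
theorem exists_tightGram_classFunction {t : ℕ} (ht : Odd t) :
    ∃ κ : ℕ → ℝ, ∀ U ∈ univ.powersetCard t, ∀ U' ∈ univ.powersetCard t,
      ∑ M : PMatch n, (if (U.filter fun x => M.2.partner x ∉ U).card = 1 then (1 : ℝ) else 0) *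
        (if (U'.filter fun x => M.2.partner x ∉ U').card = 1 then (1 : ℝ) else 0) = κ (U ∩ U').card := by
  classical
  refine ⟨fun x => if h : ∃ UU : Finset (Fin n) × Finset (Fin n),
      UU.1.card = t ∧ UU.2.card = t ∧ (UU.1 ∩ UU.2).card = x then
      ∑ M : PMatch n, (if (h.choose.1.filter fun y => M.2.partner y ∉ h.choose.1).card = 1 then (1 : ℝ) else 0) *
        (if (h.choose.2.filter fun y => M.2.partner y ∉ h.choose.2).card = 1 then (1 : ℝ) else 0) else 0,
    fun U hU U' hU' => ?_⟩
  have hUt : U.card = t := (mem_powersetCard.1 hU).2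
  have hU't : U'.card = t := (mem_powersetCard.1 hU').2
  have hex : ∃ UU : Finset (Fin n) × Finset (Fin n), UU.1.card = t ∧ UU.2.card = t ∧ (UU.1 ∩ UU.2).card = (U ∩ U').card :=
    ⟨(U, U'), hUt, hU't, rfl⟩
  dsimp only
  rw [dif_pos hex]
  obtain ⟨h1, h2, h3⟩ := hex.choose_spec
  have hoU : Odd U.card := by rw [hUt]; exact ht
  have hoU' : Odd U'.card := by rw [hU't]; exact ht
  have ho1 : Odd hex.choose.1.card := by rw [h1]; exact ht
  have ho2 : Odd hex.choose.2.card := by rw [h2]; exact ht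
  rw [tightGram_eq_card hoU hoU', tightGram_eq_card ho1 ho2]
  exact_mod_cast card_jointTight_eq (t := t) ⟨U, hoU⟩ ⟨U', hoU'⟩ ⟨_, ho1⟩ ⟨_, ho2⟩ hUt hU't h1 h2 h3.symm

/-- **Constant column sums**: the number of tight `t`-cuts is the same for every perfect matching. -/
theorem tight_colSum_eq {t : ℕ} (ht : Odd t) (M M₀ : PMatch n) :
    ∑ U ∈ univ.powersetCard t, (if (U.filter fun x => M.2.partner x ∉ U).card = 1 then (1 : ℝ) else 0) =
      (((powersetCard t (univ : Finset (Fin n))).filter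
        (fun U => (U.filter fun x => M₀.2.partner x ∉ U).card = 1)).card : ℝ) := by
  rw [← sum_filter, sum_const, nsmul_eq_mul, mul_one]
  -- both counts are the route's column counts `#{U : |U| = t, cc(U,·) = 1}`, equal by `colCount_eq`
  have hM : ∀ M' : PMatch n, (((powersetCard t (univ : Finset (Fin n))).filter
      (fun U => (U.filter fun x => M'.2.partner x ∉ U).card = 1)).card : ℝ) =
      ((univ.filter fun U : OddSet n => U.1.card = t ∧ cc U M' = 1).card : ℝ) := by
    intro M'
    have h := sum_tight_oddSet_eq M' ht (fun _ => (1 : ℝ))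
    simp only [sum_const, nsmul_eq_mul, mul_one] at h
    exact h.symm
  rw [hM M, hM M₀, colCount_eq t 1 M M₀]

/-! ### §2 The σ₂ brick modulo the even ladder eigenvalues -/

/-- **Tight-free rectangles are spectrally small (modulo the even ladder eigenvalues).** Let `t` be odd with
`2t ≤ n`, and let `Λ ≥ 0` bound the even ladder eigenvalues `kernelEigen n t (2κ') κ` (`1 ≤ κ'`, `2κ' ≤ t`) of every
Gram class function `κ` of the tight incidence on the `t`-sets. Then for every family `X` of `t`-subsets and every set
`Y` of perfect matchings with NO tight pair (`cc(U,M) ≠ 1` on `X × Y`):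
`|X| · |Y| · d_C² ≤ Λ · C(n,t) · (C(n,t) − |X|)`, where `d_C` is the (matching-independent) number of tight `t`-cuts. -/
theorem tightFree_card_mul_card_le {t : ℕ} (ht : Odd t) (htn : 2 * t ≤ n) {Λ : ℝ} (hΛ0 : 0 ≤ Λ)
    (hΛ : ∀ κ : ℕ → ℝ,
      (∀ U ∈ univ.powersetCard t, ∀ U' ∈ univ.powersetCard t,
        ∑ M : PMatch n, (if (U.filter fun x => M.2.partner x ∉ U).card = 1 then (1 : ℝ) else 0) *
          (if (U'.filter fun x => M.2.partner x ∉ U').card = 1 then (1 : ℝ) else 0) = κ (U ∩ U').card) →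
      ∀ κ' : ℕ, 1 ≤ κ' → 2 * κ' ≤ t → kernelEigen n t (2 * κ') κ ≤ Λ)
    (M₀ : PMatch n) (X : Finset (Finset (Fin n))) (hX : X ⊆ univ.powersetCard t) (Y : Finset (PMatch n))
    (hXY : ∀ U ∈ X, ∀ M ∈ Y, (U.filter fun x => M.2.partner x ∉ U).card ≠ 1) :
    (X.card : ℝ) * Y.card *
        ((((powersetCard t (univ : Finset (Fin n))).filter
          (fun U => (U.filter fun x => M₀.2.partner x ∉ U).card = 1)).card : ℝ)) ^ 2 ≤
      Λ * (n.choose t : ℝ) * ((n.choose t : ℝ) - X.card) := by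
  obtain ⟨κ, hA⟩ := exists_tightGram_classFunction (n := n) ht
  have hΛ' : ∀ j, 1 ≤ j → j ≤ t → kernelEigen n t j κ ≤ Λ := by
    intro j hj1 hjt
    rcases Nat.even_or_odd j with ⟨κ', hκ'⟩ | hodd
    · have h2 : j = 2 * κ' := by omega
      rw [h2]
      exact hΛ κ hA κ' (by omega) (by omega)
    · rw [kernelEigen_tight_eq_zero_of_odd ht htn hjt hodd κ hA]
      exact hΛ0
  have hcol := fun M : PMatch n => tight_colSum_eq ht M M₀
  have hXY' : ∑ U ∈ X, ∑ M ∈ Y, (if (U.filter fun x => M.2.partner x ∉ U).card = 1 then (1 : ℝ) else 0) = 0 :=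
    sum_eq_zero fun U hU => sum_eq_zero fun M hM => if_neg (hXY U hU M hM)
  exact card_mul_card_mul_sq_le_of_sum_eq_zero (by omega) _ κ hA hcol hΛ0 hΛ' X hX Y hXY'

end Summit.PneNP.PneNP.Theorems.ChebyshevTracialDesignTightFreeSpectral
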